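import Summits.QuantumFields.BalabanUV.Beta.GAN24.DerivativeRateTransferJensenMassFreeEnd
import Summits.QuantumFields.BalabanUV.Beta.GAN24.DerivativeRateTransferJensenMeanZeroTree

/-!
# `BalabanUV.Beta.GAN24.DerivativeRateTransferJensenMassFreeTree` — binder row G-an2-4 ∕ (CONV-C), route R6 «VALUES, NOT DERIVATIVES», PART 55:
# THE MASS-FREE END WITH THE POINCARÉ DATUM DISCHARGED — PART 53's `δ = 0` inequality for the polar pair when the block transporters are products of
# the fine transporters along rooted TREES of fine bonds (Bałaban's contours as letters): the Poincaré budgets at the TARGETS (`ϖ`) and at the SOURCES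
# (`ϖ′`) of the coarse bonds come from PART 49's tree bound with the in-degree `d′` resp. the out-degree `d″` of the coarse bond graph, so that the only
# letters left about the pair (averaging, coarse connection) are the pointwise root-frame defect `κ` and the polar symmetry `hsym`
# (unit b2b-balaban-gan24-p3, gen 43; v1)

NOT IN PRINT; OUR PROOF (for the ROUTE; [folklore] finite-dimensional linear algebra over `ℝ` — PART 49's `blockVar_le_tree` ∕ `sum_blockVar_le_tree` and
PART 53's `covJensen_polar_massFree` BY NAME).  HONEST FRAMING (cell contract, verbatim): «discharging `BetaPertH` makes Bałaban's UV stability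
UNCONDITIONAL — a real constructive-QFT result; it is NOT the continuum limit and NOT the Clay problem.»  HONEST DEPENDENCY (verbatim): «continuum YM on
T⁴ ⇐ BetaPertH ∧ nine spine estimates (0/9 proved); BetaPertH ⇐ (D1) ∧ (D4) ∧ CAP+tail; G-an2-4 gates asym, D1 and NE2/3/4.»

WHY THIS FILE.  PART 53's END carries PART 47's block Poincaré datum `Σ_x q(y,x)|W(y,x)u(x) − (Qu)(y)|² ≤ Φ(y)` with TWO budgets, `w_c·Σ_{e′}Φ(tgt′e′) ≤
ϖ·⟨u,H_fu⟩` (as in PART 47) and `w_c·Σ_{e′}Φ(src′e′) ≤ ϖ′·⟨u,H_fu⟩` (new: the mass term, once telescoped through the block means, sees the fluctuation of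
the SOURCE block too).  PART 49 (`DerivativeRateTransferJensenMeanZeroTree`) proved the datum for ROOTED TREE transporters `W(y,x) = W(y,root y)·pT(y,x,dep)`
(`blockVar_le_tree`: `Φ(y) = 4·Σ_x q(y,x)·dep(y,x)·Σ_{i<dep}|D_{pγ(y,x,i)}u|²`) and its budget over any bond-end map with fibres of size `≤ d′` and
`q·dep`-weighted tree multiplicity `≤ m_T` (`sum_blockVar_le_tree`: `4·w_c·d′·m_T ≤ ϖ·w_f`).  THIS FILE applies the budget lemma TWICE — at `tgt′`
(in-degree `d′`, `4w_c d′m_T ≤ ϖw_f`) and at `src′` (out-degree `d″`, `4w_c d″m_T ≤ ϖ′w_f`) — and feeds PART 53: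
  `⟨Qu, H_cQu⟩ ≤ (1 + t + (1+t⁻¹)(1+r)ϖκ² + (1+t⁻¹)(1+r⁻¹)·(3κ²∕(4 − κ²))·(1 + ϖ + ϖ′))·⟨u, H_f u⟩`   for all `t, r > 0` (§1 **`covJensen_polar_massFree_tree`**).
Lattice values (side `L`, dimension `d`, `q = L^{−d}`, taxi trees, `d′ = d″ = d`, `m_T ≤ d(L−1)²∕L`): `ϖ = ϖ′ = 4d²(L−1)²∕L·(w_c∕w_f)`; with Bałaban's
weights `w_c∕w_f = L^{d−2}∕(L·L^{d−2}) = 1∕L`-type bookkeeping this is an `L`-dependent constant, harmless at fixed `L` (the instantiation on PART 24's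
encoding is NOT done here; PART 54 keeps `Φ ∕ ϖ ∕ ϖ′` as data there).

WHAT THIS FILE PROVES (0 sorry, 0 `def`, nothing cited): §1 **`covJensen_polar_massFree_tree`**, **`covJensen_polar_massFree_tree_of_polar`** (the same
END with `hsym` discharged by PART 51 `wsum_defect_symm_of_polar` from the polar FACTORISATION letter «`Σ_x q·W T W′ᵀ = P·R′`, `P` symmetric»).
WHAT IT DOES NOT DO: instantiate the tree data on PART 24's lattice encoding, bound `κ` for any of Bałaban's fields, prove that the polar factor exists,
or claim anything about (CONS) ∕ exact (STAB).  SUPPLIER work on route R6 (rank 2, REDUCTION, no seat); no consumer of record; NEVER «G-an2-4 closed»;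
NOT (CONV-C), NOT D1, NOT `BetaPertH`, NOT continuum, NOT Clay.  Records: `HOME/b2b-balaban-gan24-p3/WOODBURY-FIBRE.md` v14.3. -/

noncomputable section

open Matrix Finset

namespace Summit.QuantumFields.BalabanUV.Beta.GAN24.DerivativeRateTransferJensenMassFreeTree

open Summit.QuantumFields.BalabanUV.Beta.GAN24.DerivativeRateTransferJensenMeanZeroTree
open Summit.QuantumFields.BalabanUV.Beta.GAN24.DerivativeRateTransferJensenMeanZeroPolar (wsum_defect_symm_of_polar)
open Summit.QuantumFields.BalabanUV.Beta.GAN24.DerivativeRateTransferJensenMassFreeEnd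

/-! ## §1 THE MASS-FREE END from tree data, `κ` and the polar letter -/

section End

variable {o μ ν β β' : Type*} [Fintype o] [DecidableEq o] [Fintype μ] [DecidableEq μ] [Fintype ν] [Fintype β] [DecidableEq β] [Fintype β']
variable {q : μ → ν → ℝ} {W : μ → ν → Matrix o o ℝ} {Q : Matrix (μ × o) (ν × o) ℝ}
variable {src tgt : β → ν} {R : β → Matrix o o ℝ} {src' tgt' : β' → μ} {R' : β' → Matrix o o ℝ}
variable {Hf : Matrix (ν × o) (ν × o) ℝ} {Hc : Matrix (μ × o) (μ × o) ℝ} {wf wc : ℝ}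
variable {σ : β' → ν ≃ ν} {ℓ : ℕ} {xs : β' → ν → ℕ → ν} {γ : β' → ν → ℕ → β} {T : β' → ν → ℕ → Matrix o o ℝ} {m : ℝ}
variable {N : β' → ν → Matrix o o ℝ} {κ : ℝ}
variable {root : μ → ν} {dep : μ → ν → ℕ} {pxs : μ → ν → ℕ → ν} {pγ : μ → ν → ℕ → β} {pT : μ → ν → ℕ → Matrix o o ℝ}
variable {mT ϖ ϖ' d' d'' : ℝ}

/-- **`covJensen_polar_massFree_tree` — THE MASS-FREE COVARIANT JENSEN INEQUALITY WITH THE POINCARÉ DATUM DISCHARGED** [our proof]: PART 53's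
`covJensen_polar_massFree` with `hP` ∕ `hΦ` ∕ `hΦ′` supplied by PART 49's `blockVar_le_tree` ∕ `sum_blockVar_le_tree` (block transporters = root
transporter × tree path transports; `Σ_x q(y,x) = 1`; `q·dep`-weighted tree multiplicity `≤ m_T`; in-degree `≤ d′` with `4·w_c·d′·m_T ≤ ϖ·w_f`; out-degree
`≤ d″` with `4·w_c·d″·m_T ≤ ϖ′·w_f`), the pointwise root-frame defect `κ` (`κ² < 4`) and the POLAR letter `hsym`.  For all `t, r > 0`:
`⟨Qu, H_cQu⟩ ≤ (1 + t + (1+t⁻¹)(1+r)ϖκ² + (1+t⁻¹)(1+r⁻¹)·(3κ²∕(4 − κ²))·(1 + ϖ + ϖ′))·⟨u, H_f u⟩`. -/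
theorem covJensen_polar_massFree_tree
    (hq : ∀ y x, 0 ≤ q y x) (hq1 : ∀ y, ∑ x, q y x = 1) (hW : ∀ y x, (W y x)ᵀ * W y x = 1) (hR : ∀ e, (R e)ᵀ * R e = 1)
    (hR' : ∀ e', (R' e')ᵀ * R' e' = 1)
    (hQ : ∀ (u : ν × o → ℝ) (y : μ), (fun a => (Q *ᵥ u) (y, a)) = ∑ x, q y x • (W y x *ᵥ fun b => u (x, b)))
    (hwc : 0 ≤ wc) (hd' : 0 ≤ d') (hd'' : 0 ≤ d'') (hϖ : 0 ≤ ϖ) (hϖ' : 0 ≤ ϖ')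
    (hHc : ∀ v : μ × o → ℝ, v ⬝ᵥ (Hc *ᵥ v) ≤
      wc * ∑ e', ((R' e' *ᵥ fun a => v (tgt' e', a)) - fun a => v (src' e', a)) ⬝ᵥ
        ((R' e' *ᵥ fun a => v (tgt' e', a)) - fun a => v (src' e', a)))
    (hHf : ∀ u : ν × o → ℝ, wf * ∑ e, ((R e *ᵥ fun b => u (tgt e, b)) - fun b => u (src e, b)) ⬝ᵥ
        ((R e *ᵥ fun b => u (tgt e, b)) - fun b => u (src e, b)) ≤ u ⬝ᵥ (Hf *ᵥ u))
    (hσq : ∀ e' x, q (tgt' e') (σ e' x) = q (src' e') x)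
    (hx0 : ∀ e' x, xs e' x 0 = x) (hxℓ : ∀ e' x, xs e' x ℓ = σ e' x)
    (hsrc : ∀ e' x i, i < ℓ → src (γ e' x i) = xs e' x i) (htgt : ∀ e' x i, i < ℓ → tgt (γ e' x i) = xs e' x (i + 1))
    (hT0 : ∀ e' x, T e' x 0 = 1) (hT : ∀ e' x i, i < ℓ → T e' x (i + 1) = T e' x i * R (γ e' x i))
    (hmult : ∀ e, ∑ e', ∑ x, ∑ i ∈ range ℓ, (if γ e' x i = e then q (src' e') x else 0) ≤ m)
    (hw : wc * ℓ * m ≤ wf)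
    (hNdef : ∀ e' x, N e' x = 1 - W (src' e') x * T e' x ℓ * (W (tgt' e') (σ e' x))ᵀ * (R' e')ᵀ)
    (hN : ∀ e' x (w : o → ℝ), (N e' x *ᵥ w) ⬝ᵥ (N e' x *ᵥ w) ≤ κ ^ 2 * (w ⬝ᵥ w))
    (hsym : ∀ e', (∑ x, q (src' e') x • N e' x)ᵀ = ∑ x, q (src' e') x • N e' x) (hκ : κ ^ 2 < 4)
    (hp0 : ∀ y x, pxs y x 0 = root y) (hpend : ∀ y x, pxs y x (dep y x) = x)
    (hpsrc : ∀ y x i, i < dep y x → src (pγ y x i) = pxs y x i) (hptgt : ∀ y x i, i < dep y x → tgt (pγ y x i) = pxs y x (i + 1))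
    (hpT0 : ∀ y x, pT y x 0 = 1) (hpT : ∀ y x i, i < dep y x → pT y x (i + 1) = pT y x i * R (pγ y x i))
    (hWtree : ∀ y x, W y x = W y (root y) * pT y x (dep y x))
    (hmultT : ∀ e, ∑ y, ∑ x, ∑ i ∈ range (dep y x), (if pγ y x i = e then q y x * dep y x else 0) ≤ mT)
    (hdeg : ∀ y, ((Finset.univ.filter fun e' => tgt' e' = y).card : ℝ) ≤ d')
    (hdeg' : ∀ y, ((Finset.univ.filter fun e' => src' e' = y).card : ℝ) ≤ d'')
    (hwT : 4 * wc * d' * mT ≤ ϖ * wf) (hwT' : 4 * wc * d'' * mT ≤ ϖ' * wf)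
    (u : ν × o → ℝ) {t r : ℝ} (ht : 0 < t) (hr : 0 < r) :
    (Q *ᵥ u) ⬝ᵥ (Hc *ᵥ (Q *ᵥ u)) ≤
      (1 + t + (1 + t⁻¹) * (1 + r) * ϖ * κ ^ 2 + (1 + t⁻¹) * (1 + r⁻¹) * (3 * κ ^ 2 / (4 - κ ^ 2)) * (1 + ϖ + ϖ')) *
        (u ⬝ᵥ (Hf *ᵥ u)) :=
  covJensen_polar_massFree hq hq1 hW hR hR' hQ hwc hHc hHf hσq hx0 hxℓ hsrc htgt hT0 hT hmult hw hNdef hN hsym hκ u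
    (Φ := fun u y => 4 * ∑ x, q y x * (dep y x * ∑ i ∈ range (dep y x),
        ((R (pγ y x i) *ᵥ fun b => u (tgt (pγ y x i), b)) - fun b => u (src (pγ y x i), b)) ⬝ᵥ
          ((R (pγ y x i) *ᵥ fun b => u (tgt (pγ y x i), b)) - fun b => u (src (pγ y x i), b))))
    (fun y => blockVar_le_tree hq hq1 (fun y => hW y (root y)) hR hQ hp0 hpend hpsrc hptgt hpT0 hpT hWtree u y)
    (sum_blockVar_le_tree hq hwc hd' hϖ hHf hmultT hdeg hwT u)
    (sum_blockVar_le_tree (tgt' := src') hq hwc hd'' hϖ' hHf hmultT hdeg' hwT' u) ht hr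

/-- **`covJensen_polar_massFree_tree_of_polar` — THE SAME END FROM THE POLAR FACTORISATION LETTER** [our proof]: the symmetry hypothesis `hsym`
of `covJensen_polar_massFree_tree` DISCHARGED by PART 51 `wsum_defect_symm_of_polar` from the polar convention as printed — the block mean of the OPEN
root-to-root transports factorises as `Σ_x q(src′e′,x)·W(src′e′,x)T(e′,x,ℓ)W(tgt′e′,σx)ᵀ = P_{e′}·R′_{e′}` with `P_{e′}` symmetric (`R′_{e′}` = the
orthogonal polar factor, the «Wilson average» (1.26)). -/
theorem covJensen_polar_massFree_tree_of_polar {P : β' → Matrix o o ℝ}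
    (hq : ∀ y x, 0 ≤ q y x) (hq1 : ∀ y, ∑ x, q y x = 1) (hW : ∀ y x, (W y x)ᵀ * W y x = 1) (hR : ∀ e, (R e)ᵀ * R e = 1)
    (hR' : ∀ e', (R' e')ᵀ * R' e' = 1)
    (hQ : ∀ (u : ν × o → ℝ) (y : μ), (fun a => (Q *ᵥ u) (y, a)) = ∑ x, q y x • (W y x *ᵥ fun b => u (x, b)))
    (hwc : 0 ≤ wc) (hd' : 0 ≤ d') (hd'' : 0 ≤ d'') (hϖ : 0 ≤ ϖ) (hϖ' : 0 ≤ ϖ')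
    (hHc : ∀ v : μ × o → ℝ, v ⬝ᵥ (Hc *ᵥ v) ≤
      wc * ∑ e', ((R' e' *ᵥ fun a => v (tgt' e', a)) - fun a => v (src' e', a)) ⬝ᵥ
        ((R' e' *ᵥ fun a => v (tgt' e', a)) - fun a => v (src' e', a)))
    (hHf : ∀ u : ν × o → ℝ, wf * ∑ e, ((R e *ᵥ fun b => u (tgt e, b)) - fun b => u (src e, b)) ⬝ᵥ
        ((R e *ᵥ fun b => u (tgt e, b)) - fun b => u (src e, b)) ≤ u ⬝ᵥ (Hf *ᵥ u))
    (hσq : ∀ e' x, q (tgt' e') (σ e' x) = q (src' e') x)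
    (hx0 : ∀ e' x, xs e' x 0 = x) (hxℓ : ∀ e' x, xs e' x ℓ = σ e' x)
    (hsrc : ∀ e' x i, i < ℓ → src (γ e' x i) = xs e' x i) (htgt : ∀ e' x i, i < ℓ → tgt (γ e' x i) = xs e' x (i + 1))
    (hT0 : ∀ e' x, T e' x 0 = 1) (hT : ∀ e' x i, i < ℓ → T e' x (i + 1) = T e' x i * R (γ e' x i))
    (hmult : ∀ e, ∑ e', ∑ x, ∑ i ∈ range ℓ, (if γ e' x i = e then q (src' e') x else 0) ≤ m)
    (hw : wc * ℓ * m ≤ wf)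
    (hNdef : ∀ e' x, N e' x = 1 - W (src' e') x * T e' x ℓ * (W (tgt' e') (σ e' x))ᵀ * (R' e')ᵀ)
    (hN : ∀ e' x (w : o → ℝ), (N e' x *ᵥ w) ⬝ᵥ (N e' x *ᵥ w) ≤ κ ^ 2 * (w ⬝ᵥ w))
    (hpolar : ∀ e', ∑ x, q (src' e') x • (W (src' e') x * T e' x ℓ * (W (tgt' e') (σ e' x))ᵀ) = P e' * R' e')
    (hPsymm : ∀ e', (P e')ᵀ = P e') (hκ : κ ^ 2 < 4)
    (hp0 : ∀ y x, pxs y x 0 = root y) (hpend : ∀ y x, pxs y x (dep y x) = x)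
    (hpsrc : ∀ y x i, i < dep y x → src (pγ y x i) = pxs y x i) (hptgt : ∀ y x i, i < dep y x → tgt (pγ y x i) = pxs y x (i + 1))
    (hpT0 : ∀ y x, pT y x 0 = 1) (hpT : ∀ y x i, i < dep y x → pT y x (i + 1) = pT y x i * R (pγ y x i))
    (hWtree : ∀ y x, W y x = W y (root y) * pT y x (dep y x))
    (hmultT : ∀ e, ∑ y, ∑ x, ∑ i ∈ range (dep y x), (if pγ y x i = e then q y x * dep y x else 0) ≤ mT)
    (hdeg : ∀ y, ((Finset.univ.filter fun e' => tgt' e' = y).card : ℝ) ≤ d')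
    (hdeg' : ∀ y, ((Finset.univ.filter fun e' => src' e' = y).card : ℝ) ≤ d'')
    (hwT : 4 * wc * d' * mT ≤ ϖ * wf) (hwT' : 4 * wc * d'' * mT ≤ ϖ' * wf)
    (u : ν × o → ℝ) {t r : ℝ} (ht : 0 < t) (hr : 0 < r) :
    (Q *ᵥ u) ⬝ᵥ (Hc *ᵥ (Q *ᵥ u)) ≤
      (1 + t + (1 + t⁻¹) * (1 + r) * ϖ * κ ^ 2 + (1 + t⁻¹) * (1 + r⁻¹) * (3 * κ ^ 2 / (4 - κ ^ 2)) * (1 + ϖ + ϖ')) *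
        (u ⬝ᵥ (Hf *ᵥ u)) := by
  have hsym : ∀ e', (∑ x, q (src' e') x • N e' x)ᵀ = ∑ x, q (src' e') x • N e' x := fun e' => by
    simp_rw [hNdef e']
    exact wsum_defect_symm_of_polar Finset.univ (q (src' e')) (hpolar e') (hPsymm e') (hR' e')
  exact covJensen_polar_massFree_tree hq hq1 hW hR hR' hQ hwc hd' hd'' hϖ hϖ' hHc hHf hσq hx0 hxℓ hsrc htgt hT0 hT hmult hw hNdef hN hsym hκ
    hp0 hpend hpsrc hptgt hpT0 hpT hWtree hmultT hdeg hdeg' hwT hwT' u ht hr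

end End

end Summit.QuantumFields.BalabanUV.Beta.GAN24.DerivativeRateTransferJensenMassFreeTree

end
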